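import Summits.BirchSwinnertonDyer.Rank1Residual.X10.ResidualSelmerGroup
import Summits.BirchSwinnertonDyer.Rank1Residual.GaloisImage.UnramifiedClassesIsotropic
import Literature.NumberTheory.EllipticCurves.WeilPairingTateDual
import Literature.NumberTheory.GaloisRepresentations.LocalDualityTheorem
import HarnessLib

/-!
# The `E[p]` instance of the N2 parity law, PART II: the local pairing `b_v = inv_v(· ∪ₑ ·)` as a
# bi-additive map and the reciprocity binder `hrec` (Poitou–Tate `Im β¹ ⊆ Ker γ¹`) discharged
# (cell `b2b-bsdres`, unit `b2b-bsdres-x10` = N2 class lead, GEN 31; theorems only, no definition, no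
# named fact, nothing booked — glue G2a + G4a of `class-closure/N2/P-INSTANCE-ASK-x10g31.md`)

HONEST FRAMING (run/shared/lean/b2b/bsd-rank1-residual/, verbatim in every file): the goal of the
cell is to DELETE the COMBINATION-SHAPED residual classes of the Birch–Swinnerton-Dyer formula for
ALL analytic-rank `≤ 1` elliptic curves over `ℚ` — "full BSD formula for every rank `≤ 1` curve in
class `C`" assembled STRICTLY from published theorems — so that the rank-`≤ 1` remainder becomes
exactly the CONSTRUCTION-SHAPED classes, which are TYPED (missing-input `Prop`s), NOT attempted.
This is not "finishing BSD". Class X10b (= N2) keeps its label CONSTRUCTION-SHAPED (NEEDS `X_A3`,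
referee R82.3 / RESIDUAL-MAP §I N2); this file is a TOOL; no mark / label / tier / count moves.

## What

The group-currency parity law (`X10/ResidualSelmerParityGroupForm.even_add_add_card_groupForm`, x10
GEN 31) wants at every place a bi-additive `b v : L v →+ L v →+ ZMod p` on `L v = H¹(K_v, E[p])` and the
reciprocity `hrec : ∑_{v ∈ S'} b_v(loc_v c, loc_v d) = 0` for classes `c, d` unramified outside
`S' ⊇ S₀`. THE CHOICE of the dictionary (P-INSTANCE-ASK §1, G2a): `b_v(x, y) = inv_v(x ∪_{e,v} y)`,
the local WEIL cup product `H¹(K_v, E[p]) × H¹(K_v, E[p]) → H²(K_v, μ_p)` of the tree's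
`weilContPairingLocal` (`Literature/NumberTheory/EllipticCurves/WeilPairingTateDual.lean`) followed by
the invariant map `inv_v` of a family `inv : LocalInvariants K p` (the family of the ONE named fact
`poitouTate_selmerStructure_duality`, whose conjunct `SumLocalTermEqZero` is used here as a
HYPOTHESIS on `inv`, nothing asserted). For a Weil pairing `e` on `E[p]` (biadditive, `μ_p`-valued,
Galois-equivariant — the data of `WeierstrassCurve.exists_weilPairing`, kept as binders as in the
tree):

* §1 `exists_biadditive_invWeilCup` — `b v` EXISTS as a bi-additive map with
  `b v x y = inv_v ((weilContPairingLocal … v).cupProduct x y)` (the cup product is `ℤ`-bilinear);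
* §2 `inv_weilCup_localization_eq_zero_of_mem_residual` — at a finite `v ∤ p`, two classes
  satisfying the RESIDUAL condition (= unramified, `X10/ResidualSelmerGroup`) pair to `0`: team
  n1011's isotropy of unramified classes for an ARBITRARY pairing over a local field
  (`GaloisImage/UnramifiedClassesIsotropic.cupProduct_eq_zero_of_mem_unramifiedSubgroup`, `cd(Ẑ) = 1`);
* §3 **`hrec`** `sum_inv_weilCup_localization_eq_zero_of_residual` — for `inv` with
  `SumLocalTermEqZero` and a finite `S'` containing the archimedean places and the places above `p`,
  and `c, d ∈ H¹(K, E[p])` satisfying the residual condition at every `v ∉ S'`: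
  `∑_{v ∈ S'} inv_v(loc_v c ∪_{e,v} loc_v d) = 0` — the tree's
  `sum_inv_weilCupProduct_localization_eq_zero` (Milne I 4.10(b) for the pair `(c, w_* d)`) with the
  off-`S'` terms killed by §2. This is LITERALLY the binder `hrec` of the group-currency law for
  `Λ := residualSelmerStructure W p`, `S₀ := {v ∣ ∞} ∪ {v ∣ p}` (∪ anything).

Left (ASK G2b/G2c/G3/G4b/G6/G8): symmetry of `b v` (from `e` alternating and graded commutativity),
nondegeneracy (`IsPerfect` + Weil dual bijective), `hΛ`, `hPT`, `hX`, local term one.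

## References

* [MilneADT2006] J. S. Milne, *Arithmetic Duality Theorems*, I Thm. 4.10(b), §2 Prop. 2.6, §6 proof of
  Prop. 6.9.
* [KlagsbrunMazurRubin2013] Thm. 3.1 (ii)–(iii); [MazurRubin2007] §1.
* HOME/class-closure/N2/P-INSTANCE-ASK-x10g31.md; HOME/X10-AUDIT.md §37.
-/

set_option autoImplicit false

noncomputable section

open scoped Classical

open WeierstrassCurve Field Literature.NumberTheory.EllipticCurves Literature.NumberTheory.GaloisRepresentations
  Literature.NumberTheory.GaloisCohomology NumberField IsDedekindDomain
open Literature.NumberTheory.GaloisRepresentations.DiscreteGaloisModule (unramifiedSubgroup SelmerStructure mu)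
open Summit.BirchSwinnertonDyer.Rank1Residual.X10.ResidualSelmerGroup
open Summit.BirchSwinnertonDyer.Rank1Residual.GaloisImage.TwoLagrangianLines

namespace Summit.BirchSwinnertonDyer.Rank1Residual.X10.ResidualSelmerReciprocity

-- Cup products need `LocallyCompactSpace Γ_{K_v}` (in the tree a LOCAL instance,
-- `absoluteGaloisGroup_compactSpace`); as in team n1011's files it is an instance HYPOTHESIS here.

variable {K : Type} [Field K] [NumberField K] (W : WeierstrassCurve K) (p : ℕ) [Fact p.Prime]
  [W.IsElliptic]
variable (e : geomTorsion W p → geomTorsion W p → AlgebraicClosure K)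
  (hμ : ∀ S T, e S T ^ p = 1)
  (hadd₁ : ∀ S₁ S₂ T, e (S₁ + S₂) T = e S₁ T * e S₂ T)
  (hadd₂ : ∀ S T₁ T₂, e S (T₁ + T₂) = e S T₁ * e S T₂)
  (hgal : ∀ (σ : absoluteGaloisGroup K) (S T : geomTorsion W p), σ • e S T = e (σ • S) (σ • T))

/-! ### §0. An alternating pairing is skew (the input `hskew` of `WeilCupSymmetric`) -/

include hμ hadd₁ hadd₂ in
omit [NumberField K] [W.IsElliptic] in
/-- An ALTERNATING biadditive `μ_p`-valued pairing (`e(T, T) = 1`, as delivered by the tree's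
`exists_weilPairing`, Silverman III.8.1 (b)) is SKEW: `e(T, S) = e(S, T)⁻¹` — the hypothesis `hskew` of
`X10/WeilCupSymmetric.weilCupLocal_symm` (expand `e(S + T, S + T) = 1`).
[cite: SilvermanAEC2009, Prop. III.8.1 (b)] -/
theorem skew_of_alt (halt : ∀ T, e T T = 1) (S T : geomTorsion W p) : e T S = (e S T)⁻¹ := by
  have hne : e S T ≠ 0 := fun h => by
    have := hμ S T
    rw [h, zero_pow (Fact.out : p.Prime).ne_zero] at this
    exact zero_ne_one this
  have h := halt (S + T)
  rw [hadd₁, hadd₂, hadd₂, halt S, halt T, one_mul, mul_one] at h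
  -- `h : e S T * e T S = 1`
  exact eq_inv_of_mul_eq_one_right h

/-! ### §1. `b v = inv_v(· ∪ₑ ·)` as a bi-additive map -/

omit [W.IsElliptic] in
/-- **G2a — the local pairing of the dictionary exists as a bi-additive map**: for every place `v`
there is `b v : H¹(K_v, E[p]) →+ H¹(K_v, E[p]) →+ ℤ/p` with `b v x y = inv_v(x ∪_{e,v} y)` (the cup
product of `weilContPairingLocal` is bilinear; `inv_v` is additive). [folklore] -/
theorem exists_biadditive_invWeilCup
    [∀ v : Place K, LocallyCompactSpace (absoluteGaloisGroup (Place.Completion v))]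
    (inv : LocalInvariants K p) :
    ∃ b : ∀ v : Place K, galoisCohomology ((W.torsionGaloisModule p).toLocal v) 1 →+
        galoisCohomology ((W.torsionGaloisModule p).toLocal v) 1 →+ ZMod p,
      ∀ v x y, b v x y =
        inv v ((weilContPairingLocal W p e hμ hadd₁ hadd₂ hgal v).cupProduct x y) :=
  ⟨fun v =>
    { toFun := fun x =>
        (inv v).comp ((weilContPairingLocal W p e hμ hadd₁ hadd₂ hgal v).cupProduct x).toAddMonoidHom
      map_zero' := AddMonoidHom.ext fun y =>
        (congrArg (inv v) (DFunLike.congr_fun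
          (map_zero (weilContPairingLocal W p e hμ hadd₁ hadd₂ hgal v).cupProduct) y)).trans
          (map_zero (inv v))
      map_add' := fun x x' => AddMonoidHom.ext fun y => by
        change inv v ((weilContPairingLocal W p e hμ hadd₁ hadd₂ hgal v).cupProduct (x + x') y) =
          inv v ((weilContPairingLocal W p e hμ hadd₁ hadd₂ hgal v).cupProduct x y) +
            inv v ((weilContPairingLocal W p e hμ hadd₁ hadd₂ hgal v).cupProduct x' y)
        rw [← map_add (inv v)]
        exact congrArg (inv v) (DFunLike.congr_fun
          (map_add (weilContPairingLocal W p e hμ hadd₁ hadd₂ hgal v).cupProduct x x') y) },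
    fun _ _ _ => rfl⟩

/-! ### §2. Off `S'`: residual (= unramified) classes pair to zero -/

omit [W.IsElliptic] in
/-- At a finite place `v ∤ p`, two local classes satisfying the residual condition (the unramified
subgroup) have Weil cup product `0`, hence local term `0` (n1011: unramified classes are isotropic for
EVERY pairing over a local field, `cd(Γ/I) = 1`). [cite: MilneADT2006, Ch. I §2, Prop. 2.6 and proof of Thm. 2.6] -/
theorem inv_weilCup_eq_zero_of_mem_residual (inv : LocalInvariants K p) {v : HeightOneSpectrum (𝓞 K)}
    [LocallyCompactSpace (absoluteGaloisGroup (Place.Completion (Sum.inr v : Place K)))]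
    (hv : (p : 𝓞 K) ∉ v.asIdeal)
    {x y : galoisCohomology ((W.torsionGaloisModule p).toLocal (Sum.inr v)) 1}
    (hx : x ∈ residualSelmerStructure W p (Sum.inr v)) (hy : y ∈ residualSelmerStructure W p (Sum.inr v)) :
    inv (Sum.inr v) ((weilContPairingLocal W p e hμ hadd₁ hadd₂ hgal (Sum.inr v)).cupProduct x y) = 0 := by
  rw [residualSelmerStructure_inr_of_not_mem W p hv] at hx hy
  haveI : Finite (DiscreteGaloisModule.MuCarrier K p) := finite_muCarrier K p
  haveI : LocallyCompactSpace (absoluteGaloisGroup (v.adicCompletion K)) :=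
    ‹LocallyCompactSpace (absoluteGaloisGroup (Place.Completion (Sum.inr v : Place K)))›
  have h0 : (weilContPairingLocal W p e hμ hadd₁ hadd₂ hgal (Sum.inr v)).cupProduct x y = 0 :=
    cupProduct_eq_zero_of_mem_unramifiedSubgroup
      (ρA := GaloisRep.toLocal v (W.torsionGaloisModule p))
      (ρB := GaloisRep.toLocal v (W.torsionGaloisModule p))
      (ρC := GaloisRep.toLocal v (mu K p))
      (weilContPairingLocal W p e hμ hadd₁ hadd₂ hgal (Sum.inr v)) hx hy
  rw [h0]
  exact map_zero (inv (Sum.inr v))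

/-! ### §3. `hrec`: the reciprocity binder -/

/-- **G4a — `hrec` discharged.** Let `inv` satisfy the Poitou–Tate vanishing (`SumLocalTermEqZero`, a
conjunct of `poitouTate_selmerStructure_duality`), let `S'` be a finite set of places containing every
archimedean place and every place above `p`, and let `c, d ∈ H¹(K, E[p])` satisfy the residual
condition at every `v ∉ S'`. Then `∑_{v ∈ S'} inv_v(loc_v c ∪_{e,v} loc_v d) = 0` — the binder `hrec`
of `ResidualSelmerParityGroupForm.even_add_add_card_groupForm` for the dictionary
`b v = inv_v(· ∪ₑ ·)`, `Λ = residualSelmerStructure W p`. [cite: MilneADT2006, Ch. I, Thm. 4.10(b)]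
[cite: KlagsbrunMazurRubin2013, Thm. 3.1 (iii)] -/
theorem sum_inv_weilCup_localization_eq_zero_of_residual
    [∀ v : Place K, LocallyCompactSpace (absoluteGaloisGroup (Place.Completion v))]
    (inv : LocalInvariants K p) (hPT : inv.SumLocalTermEqZero) {S' : Finset (Place K)}
    (hS : ∀ w : InfinitePlace K, (Sum.inl w : Place K) ∈ S')
    (hSp : ∀ v : HeightOneSpectrum (𝓞 K), (p : 𝓞 K) ∈ v.asIdeal → (Sum.inr v : Place K) ∈ S')
    (c d : galH1Torsion W (p : ℤ))
    (hc : ∀ v, v ∉ S' → galoisCohomology.localization (W.torsionGaloisModule p) v 1 c ∈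
      residualSelmerStructure W p v)
    (hd : ∀ v, v ∉ S' → galoisCohomology.localization (W.torsionGaloisModule p) v 1 d ∈
      residualSelmerStructure W p v) :
    ∑ v ∈ S', inv v ((weilContPairingLocal W p e hμ hadd₁ hadd₂ hgal v).cupProduct
      (galoisCohomology.localization (W.torsionGaloisModule p) v 1 c)
      (galoisCohomology.localization (W.torsionGaloisModule p) v 1 d)) = 0 := by
  refine sum_inv_weilCupProduct_localization_eq_zero W p e hμ hadd₁ hadd₂ hgal inv hPT c d S' ?_
  rintro (w | v) hv
  · exact absurd (hS w) hv
  · exact inv_weilCup_eq_zero_of_mem_residual W p e hμ hadd₁ hadd₂ hgal inv (fun h => hv (hSp v h))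
      (hc _ hv) (hd _ hv)

/-- **`hrec` in the exact shape of the group-currency law** (with the bi-additive `b` of §1 and any
`S₀` containing the archimedean places and the places above `p`): for every finite `S'' ⊇ S₀` and all
`c, d` with the residual condition off `S''`, `∑_{v ∈ S''} b_v(loc_v c, loc_v d) = 0`.
[cite: MilneADT2006, Ch. I, Thm. 4.10(b)] -/
theorem hrec_of_sumLocalTermEqZero
    [∀ v : Place K, LocallyCompactSpace (absoluteGaloisGroup (Place.Completion v))]
    (inv : LocalInvariants K p) (hPT : inv.SumLocalTermEqZero)
    (b : ∀ v : Place K, galoisCohomology ((W.torsionGaloisModule p).toLocal v) 1 →+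
        galoisCohomology ((W.torsionGaloisModule p).toLocal v) 1 →+ ZMod p)
    (hb : ∀ v x y, b v x y = inv v ((weilContPairingLocal W p e hμ hadd₁ hadd₂ hgal v).cupProduct x y))
    {S₀ : Finset (Place K)} (hS : ∀ w : InfinitePlace K, (Sum.inl w : Place K) ∈ S₀)
    (hSp : ∀ v : HeightOneSpectrum (𝓞 K), (p : 𝓞 K) ∈ v.asIdeal → (Sum.inr v : Place K) ∈ S₀) :
    ∀ S'' : Finset (Place K), S₀ ⊆ S'' → ∀ c d : galH1Torsion W (p : ℤ),
      (∀ v, v ∉ S'' → galoisCohomology.localization (W.torsionGaloisModule p) v 1 c ∈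
        residualSelmerStructure W p v) →
      (∀ v, v ∉ S'' → galoisCohomology.localization (W.torsionGaloisModule p) v 1 d ∈
        residualSelmerStructure W p v) →
      ∑ v ∈ S'', b v (galoisCohomology.localization (W.torsionGaloisModule p) v 1 c)
        (galoisCohomology.localization (W.torsionGaloisModule p) v 1 d) = 0 := by
  intro S'' hS'' c d hc hd
  simp only [hb]
  exact sum_inv_weilCup_localization_eq_zero_of_residual W p e hμ hadd₁ hadd₂ hgal inv hPT
    (fun w => hS'' (hS w)) (fun v h => hS'' (hSp v h)) c d hc hd

end Summit.BirchSwinnertonDyer.Rank1Residual.X10.ResidualSelmerReciprocity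

end
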